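import Summits.AtomisticToContinuum.Crystallization.Theorems.PalmUnimodularRigidityShellsToBarlowChartDevelopCovering

/-!
# Combinatorial layering (B1a of `GapTwelveToBarlow`): reachability along bond walks in a finite development

Crux `SquareWellLayerCake.GapTwelveToBarlow` (stmt-AtomisticToContinuum-15807), line `Sketch`,
stub `stub_develop` (H_develop).  COVERAGE step of the metric closure: if `Φ : ℝ³ → Fin N`
develops the model `barlowStacking 1 √(2/3) s` STAR-surjectively at every covered model point
(covered = `|k| + 1 ≤ K`, `|j| + |i| + 3(|k| + 1) + 4 ≤ R`, the diamond of `develop_of_base`),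
then every site joined to the base `Φ 0` by a bond walk of length `m` (`m + 2 ≤ K`, `4m + 7 ≤ R`)
is the image of a model point `barlowPos … k i j` with `|k| ≤ m` and `|j| + |i| + 3|k| ≤ 4m`
(`reach_of_walk`, anchor): a model contact changes the layer index by at most `1` and the
quantity `|j| + |i| + 3|k|` by at most `4` (`linkOffsets_bounds`, `exists_contact_coords`).
Walks are coded as `c : ℕ → Fin N` with consecutive entries equal or bonded.  All `[folklore]`.
-/

noncomputable section

namespace Summit.AtomisticToContinuum.Crystallization.Theorems.SquareWellLayerCakeGapTwelveToBarlow

open Literature.Geometry.DiscreteGeometry Literature.MathematicalPhysics.StatisticalMechanics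
open Summit.AtomisticToContinuum.Crystallization.Theorems.PalmUnimodularRigidityShellsToBarlowChart.DevelopCovering
  (relPos_eq_barlowPos)

/-- The twelve contact offsets change the layer by at most one and `|Q| + |P| + 3|r|` by at most
four (in-layer offsets have `|P| + |Q| ≤ 2`, adjacent-layer offsets `|P| + |Q| ≤ 1`). [folklore] -/
theorem linkOffsets_bounds : ∀ σm ∈ ({1, -1} : Finset ℤ), ∀ σp ∈ ({1, -1} : Finset ℤ),
    ∀ y ∈ linkOffsets σm σp, y.1.natAbs ≤ 1 ∧ y.2.2.natAbs + y.2.1.natAbs + 3 * y.1.natAbs ≤ 4 := by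
  decide

/-- **Coordinates of a model contact.**  A point of the stacking at distance `1` from
`barlowPos 1 √(2/3) s k i j` is `barlowPos 1 √(2/3) s (k + r) (i − P) (j − Q)` with `|r| ≤ 1` and
`|Q| + |P| + 3|r| ≤ 4`. [folklore] -/
theorem exists_contact_coords {s : ℤ → ℤ} (hs : IsHaggSeq s) (k i j : ℤ)
    {q : EuclideanSpace ℝ (Fin 3)} (hq : q ∈ barlowStacking 1 (Real.sqrt (2 / 3)) s)
    (hd : dist (barlowPos 1 (Real.sqrt (2 / 3)) s k i j) q = 1) :
    ∃ r P Q : ℤ, r.natAbs ≤ 1 ∧ Q.natAbs + P.natAbs + 3 * r.natAbs ≤ 4 ∧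
      q = barlowPos 1 (Real.sqrt (2 / 3)) s (k + r) (i - P) (j - Q) := by
  obtain ⟨y, hy, rfl⟩ := (touching_iff_exists_linkOffsets hs one_pos
    ShellsToBarlowChartNegative.sqrt_two_thirds_sq k i j q).1 ⟨hq, hd⟩
  have hm : s (k - 1) ∈ ({1, -1} : Finset ℤ) := by
    rcases hs (k - 1) with h | h <;> simp [h]
  have hp : s k ∈ ({1, -1} : Finset ℤ) := by
    rcases hs k with h | h <;> simp [h]
  obtain ⟨h1, h2⟩ := linkOffsets_bounds _ hm _ hp y hy
  exact ⟨y.1, y.2.1, y.2.2, h1, h2, relPos_eq_barlowPos _ _ _ _ _ _ _⟩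

/-- **Reachability along bond walks** (anchor of this file).  If `Φ` develops the model
STAR-surjectively at every covered model point, every site joined to the base by a bond walk of
length `m` with `m + 2 ≤ K`, `4m + 7 ≤ R` is the image of a covered-range model point:
`|k| ≤ m`, `|j| + |i| + 3|k| ≤ 4m`. [folklore] -/
theorem reach_of_walk :
    ∀ (N : ℕ) (x : Fin N → EuclideanSpace ℝ (Fin 3)) (s : ℤ → ℤ) (Φ : EuclideanSpace ℝ (Fin 3) →
    Fin N) (b : Fin N) (K R : ℕ), IsHaggSeq s → Φ (barlowPos 1 (Real.sqrt (2 / 3)) s 0 0 0) = b →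
    (∀ k i j : ℤ, k.natAbs + 1 ≤ K → j.natAbs + i.natAbs + 3 * (k.natAbs + 1) + 4 ≤ R → ∀ l : Fin
    N, l ≠ Φ (barlowPos 1 (Real.sqrt (2 / 3)) s k i j) → dist (x (Φ (barlowPos 1 (Real.sqrt (2 /
    3)) s k i j))) (x l) ≤ 1 → ∃ q ∈ barlowStacking 1 (Real.sqrt (2 / 3)) s, dist (barlowPos 1
    (Real.sqrt (2 / 3)) s k i j) q = 1 ∧ Φ q = l) → ∀ (m : ℕ) (c : ℕ → Fin N), c 0 = b → (∀ t : ℕ,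
    t < m → c t = c (t + 1) ∨ dist (x (c t)) (x (c (t + 1))) ≤ 1) → m + 2 ≤ K → 4 * m + 7 ≤ R →
    ∃ k i j : ℤ, k.natAbs ≤ m ∧ j.natAbs + i.natAbs + 3 * k.natAbs ≤ 4 * m ∧ Φ (barlowPos 1
    (Real.sqrt (2 / 3)) s k i j) = c m := by
  intro N x s Φ b K R hs hb hstar m
  induction m with
  | zero =>
    intro c hc0 _ _ _
    exact ⟨0, 0, 0, by simp, by simp, by rw [hb, hc0]⟩
  | succ m ih =>
    intro c hc0 hw hK hR
    obtain ⟨k, i, j, hk, hij, hΦ⟩ := ih c hc0 (fun t ht => hw t (by omega)) (by omega) (by omega)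
    rcases hw m (by omega) with he | hbond
    · exact ⟨k, i, j, by omega, by omega, by rw [hΦ, he]⟩
    · by_cases heq : c (m + 1) = Φ (barlowPos 1 (Real.sqrt (2 / 3)) s k i j)
      · exact ⟨k, i, j, by omega, by omega, heq.symm⟩
      · rw [← hΦ] at hbond
        obtain ⟨q, hqS, hqd, hqΦ⟩ := hstar k i j (by omega) (by omega) (c (m + 1)) heq hbond
        obtain ⟨r, P, Q, hr, hPQ, rfl⟩ := exists_contact_coords hs k i j hqS hqd
        refine ⟨k + r, i - P, j - Q, ?_, ?_, hqΦ⟩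
        · have := Int.natAbs_add_le k r; omega
        · have h1 := Int.natAbs_add_le k r
          have h2 := Int.natAbs_sub_le i P
          have h3 := Int.natAbs_sub_le j Q
          omega

end Summit.AtomisticToContinuum.Crystallization.Theorems.SquareWellLayerCakeGapTwelveToBarlow
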